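import Summits.ResolutionOfSingularities.ResolutionOfSingularities.Theorems.WeightedInvariantIotaOrdEpsTauUpperSemicontinuousLE
import Summits.ResolutionOfSingularities.ResolutionOfSingularities.Theorems.WeightedInvariantContactCylinderStratumLocalizeFlatT
import Summits.ResolutionOfSingularities.ResolutionOfSingularities.Theorems.WeightedInvariantIota3DominanceWordResidueAtPowers
import Literature.AlgebraicGeometry.Resolution.SmoothStalksRegular
import HarnessLib

/-!
# THE GAP hc8 OF THE P3 RUNG CLOSED: (c8)≤3 for the invariant of record `ι₃ᵗ = Iota3.iotaFlatT`, UNCONDITIONALLY — the cylinder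
# reading of ANY iso-invariant letter along the `ι₀`-strata is upper semicontinuous (door `HypersurfaceCentreConstruction`,
# stmt-ResolutionOfSingularities-19897; registered stub `stub_keyRungGrHomLE_three`, gap list `keyRungGrHomLE_three_of_residue_at_powers`)

Topic: `Summits/ResolutionOfSingularities/ResolutionOfSingularities/Theorems`. Helper for the door item `HypersurfaceCentreConstruction`
(stmt-ResolutionOfSingularities-19897, route `WeightedInvariant`), line `local-engine`, def-free.  Sequel of …IotaOrdEpsTauUpperSemicontinuousLE
((c8)≤3 for the stratifier `ι₀ = (ν ; ε ; τ)`).  THE STRATUM-RELATIVE CLAUSE FOR THE CYLINDER READING: on a smooth quasi-compact `Y` over a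
perfect field with all stalks of dimension `≤ 3`, for `f ∈ Γ(Y, 𝒪_Y)` and ordinals `α, β`, the set `{ι₀ = α ∧ β ≤ iotaCylinder ι₀ ι}` is the
trace on the stratum `{ι₀ = α}` of the CLOSED set `⋃ closure {x}` over the finitely many points `x` MAXIMAL in the closed super-level set
`{α ≤ ι₀}` with `ι₀(x) = α` and `β ≤ ι(𝒪_{Y,x}, f_x)` — for every iso-invariant second letter `ι` (no semicontinuity of `ι` is used: the
cylinder reads `ι` at the generic point `η(y)` of the top `ι₀`-stratum `V(P₀)` of `Spec 𝒪_{Y,y}`, and `η(y)` is the unique maximal point of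
`{α ≤ ι₀}` above `y` inside the stratum, by (c7) for `ι₀`).

* `GenerizationClosed.exists_prime_of_specializes` — the chart dictionary, point-to-prime direction: for `x ⤳ y` in an affine chart the prime
  `𝔮_x · 𝒪_{Y,y}` contracts to `𝔮_x` and iso-invariant predicates transfer between `((𝒪_{Y,y})_{𝔮_x 𝒪}, f_y/1)` and `(𝒪_{Y,x}, f_x)`;
* `Iota3.iotaOrdEpsTau_le_of_specializes` — (c7) for `ι₀` along specialisations of points of a smooth `Y`;
* **`Iota3.iotaCylinder_upperSemicontinuousOnLE_three`** — `IotaUpperSemicontinuousOnLE 3 p iotaOrdEpsTau (iotaCylinder iotaOrdEpsTau ι)` for every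
  iso-invariant `ι` and every `p`;
* **`Iota3.iotaFlatT_upperSemicontinuousLE_three : IotaUpperSemicontinuousLE 3 p iotaFlatT`** — THE GAP hc8, UNCONDITIONAL;
* `keyRungGrHomLE_three_of_residue_at_powers'` — the P3 rung for the named pair modulo the REMAINING gap list: hc10, hc11, hgame, the residue of
  the dominance word at the power positions, hgr (hc8 discharged).

[OURS · L1 W4.3 · (c8-cyl)≤3 / hc8]  Replaces the role of NO printed item; NOT a statement of the manuscript under review
[claim: Hironaka2017, status: under-review]; candidates stay candidates; AI work, weaker than expert review; no claim about resolution of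
singularities in characteristic `p` beyond the typed statements.  No definition; no axiom; no named fact taken as hypothesis beyond the clause
words of the line.

## References

* A. Grothendieck, EGA I 1.3 (stalks of affine schemes are localisations); EGA IV 0.2.1 (Noetherian sober spaces). [folklore]
* V. Cossart, U. Jannsen, S. Saito, *Desingularization: invariants and strategy*, LNM 2270 (2020), Ch. 2 (semicontinuity of stratifying
  invariants along strata). [CossartJannsenSaito2020]
-/

noncomputable section

set_option linter.dupNamespace false -- mandated namespace `Summit.<Summit>.<Problem>` of this single-conjunct summit

open CategoryTheory AlgebraicGeometry TopologicalSpace IsLocalRing Topology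
open Literature.AlgebraicGeometry.Resolution
open Summit.ResolutionOfSingularities.ResolutionOfSingularities.Theorems
open Summit.ResolutionOfSingularities.ResolutionOfSingularities.Theorems.ContactCylinder

namespace Summit.ResolutionOfSingularities.ResolutionOfSingularities.Cruxes.HypersurfaceCentreConstruction.LocalEngine

/-! ## §1 The chart dictionary, point-to-prime direction -/

namespace GenerizationClosed

/-- **A generization `x ⤳ y` read on a prime of `𝒪_{Y,y}`.**  For `y` in an affine chart `U` and `x ⤳ y` (so `x ∈ U`): the prime
`Q = 𝔮_x · 𝒪_{Y,y}` of `𝒪_{Y,y}` contracts to `𝔮_x` in `Γ(Y, U)`, and every iso-invariant predicate of the position `((𝒪_{Y,y})_Q, f_y/1)` is the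
same predicate of `(𝒪_{Y,x}, f_x)` (the block of `exists_generization_iff_exists_specializes`, exposed). [folklore] -/
theorem exists_prime_of_specializes {Y : Scheme.{0}} (U : Y.affineOpens) (f : Γ(Y, ⊤)) {y x : Y}
    (hy : y ∈ (U : Y.Opens)) (hx : x ∈ (U : Y.Opens)) (hxy : x ⤳ y) :
    letI := TopCat.Presheaf.algebra_section_stalk Y.presheaf (⟨y, hy⟩ : (U : Y.Opens))
    ∃ Q : PrimeSpectrum (Y.presheaf.stalk y),
      Q.asIdeal.comap (algebraMap Γ(Y, U) (Y.presheaf.stalk y)) = (U.2.primeIdealOf ⟨x, hx⟩).asIdeal ∧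
      ∀ (P : (R : Type) → [CommRing R] → R → Prop),
        (∀ (R T : Type) [CommRing R] [CommRing T] (e : R ≃+* T) (g : R), P R g ↔ P T (e g)) →
        (P (Localization.AtPrime Q.asIdeal)
            (algebraMap (Y.presheaf.stalk y) (Localization.AtPrime Q.asIdeal) ((Y.presheaf.germ ⊤ y trivial) f)) ↔
          P (Y.presheaf.stalk x) ((Y.presheaf.germ ⊤ x trivial) f)) := by
  letI algy := TopCat.Presheaf.algebra_section_stalk Y.presheaf (⟨y, hy⟩ : (U : Y.Opens))
  haveI hlocy : IsLocalization.AtPrime (Y.presheaf.stalk y) (U.2.primeIdealOf ⟨y, hy⟩).asIdeal :=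
    U.2.isLocalization_stalk ⟨y, hy⟩
  letI algx := TopCat.Presheaf.algebra_section_stalk Y.presheaf (⟨x, hx⟩ : (U : Y.Opens))
  haveI hlocx : IsLocalization.AtPrime (Y.presheaf.stalk x) (U.2.primeIdealOf ⟨x, hx⟩).asIdeal :=
    U.2.isLocalization_stalk ⟨x, hx⟩
  have hle := primeIdealOf_le_of_specializes U hy hx hxy
  have hdisj : Disjoint ((U.2.primeIdealOf ⟨y, hy⟩).asIdeal.primeCompl : Set Γ(Y, U))
      ((U.2.primeIdealOf ⟨x, hx⟩).asIdeal : Set Γ(Y, U)) := by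
    rw [Set.disjoint_left]
    intro a ha ha'
    exact ha (hle ha')
  set 𝔓 : Ideal (Y.presheaf.stalk y) :=
    (U.2.primeIdealOf ⟨x, hx⟩).asIdeal.map (algebraMap Γ(Y, U) (Y.presheaf.stalk y)) with h𝔓
  haveI h𝔓p : 𝔓.IsPrime :=
    IsLocalization.isPrime_of_isPrime_disjoint (U.2.primeIdealOf ⟨y, hy⟩).asIdeal.primeCompl _ _ inferInstance hdisj
  have hcomap : 𝔓.comap (algebraMap Γ(Y, U) (Y.presheaf.stalk y)) = (U.2.primeIdealOf ⟨x, hx⟩).asIdeal :=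
    IsLocalization.under_map_of_isPrime_disjoint _ _ inferInstance hdisj
  refine ⟨⟨𝔓, h𝔓p⟩, hcomap, fun P hP => ?_⟩
  have hM : (𝔓.comap (algebraMap Γ(Y, U) (Y.presheaf.stalk y))).primeCompl =
      (U.2.primeIdealOf ⟨x, hx⟩).asIdeal.primeCompl := by
    ext a; simp only [Ideal.mem_primeCompl_iff, hcomap]
  have hloc : IsLocalization (𝔓.comap (algebraMap Γ(Y, U) (Y.presheaf.stalk y))).primeCompl (Y.presheaf.stalk x) := by
    rw [hM]
    exact hlocx
  exact localization_stalk_iff P U hP f hy ⟨𝔓, h𝔓p⟩ hx hloc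

end GenerizationClosed

namespace Iota3

/-! ## §2 (c7) for the stratifier along specialisations of points -/

section Specializes

variable {k₀ : Type} [Field k₀] {Y : Scheme.{0}} (hY : Y ⟶ Spec (CommRingCat.of k₀)) [Smooth hY]

include hY in
/-- **(c7) for `ι₀` along points**: on a smooth `Y` over a field, `x ⤳ y` implies `ι₀(𝒪_{Y,x}, f_x) ≤ ι₀(𝒪_{Y,y}, f_y)` (`𝒪_{Y,x}` is a
localisation of the regular local ring `𝒪_{Y,y}`; `iotaOrdEpsTau_generizationMonotone`). [OURS] -/
theorem iotaOrdEpsTau_le_of_specializes (f : Γ(Y, ⊤)) {y x : Y} (hxy : x ⤳ y) :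
    iotaOrdEpsTau (Y.presheaf.stalk x) ((Y.presheaf.germ ⊤ x trivial) f) ≤
      iotaOrdEpsTau (Y.presheaf.stalk y) ((Y.presheaf.germ ⊤ y trivial) f) := by
  have hytop : y ∈ (⊤ : Y.Opens) := trivial
  rw [← iSup_affineOpens_eq_top Y] at hytop
  obtain ⟨U, hy⟩ := Opens.mem_iSup.mp hytop
  have hx : x ∈ (U : Y.Opens) := hxy.mem_open U.1.isOpen hy
  haveI : IsRegularLocalRing (Y.presheaf.stalk y) := isRegularLocalRing_stalk_of_smooth_of_field hY y
  obtain ⟨Q, -, htrans⟩ := GenerizationClosed.exists_prime_of_specializes U f hy hx hxy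
  have h := (htrans (fun R _ g => iotaOrdEpsTau R g =
      iotaOrdEpsTau (Y.presheaf.stalk x) ((Y.presheaf.germ ⊤ x trivial) f))
    (fun R T _ _ e g => by rw [iotaOrdEpsTau_isoInvariant R T e g])).mpr rfl
  rw [← h]
  exact iotaOrdEpsTau_generizationMonotone (Y.presheaf.stalk y) Q.asIdeal _

end Specializes

/-! ## §3 The cylinder clause along the `ι₀`-strata -/

/-- At a regular local ring of Krull dimension `≤ 3` the top `ι₀`-stratum is `V(P)` for a prime `P` (`⊥` at `f = 0` and at units,
(strat-τ) `topStratum_iotaOrdEpsTau_eq` otherwise). [OURS] -/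
theorem exists_topStratum_iotaOrdEpsTau_eq (S : Type) [CommRing S] [IsRegularLocalRing S] (hdim : ringKrullDim S ≤ 3) (f : S) :
    ∃ (P : Ideal S) (_ : P.IsPrime), topStratum iotaOrdEpsTau S f = {𝔮 | P ≤ 𝔮.asIdeal} := by
  haveI := isDomain_of_isRegularLocalRing S
  by_cases hf0 : f = 0
  · subst hf0
    exact ⟨⊥, Ideal.isPrime_bot, topStratum_iotaOrdEpsTau_zero_eq_bot S hdim⟩
  by_cases hfu : IsUnit f
  · exact ⟨⊥, Ideal.isPrime_bot, topStratum_iotaOrdEpsTau_of_isUnit_eq_bot S hdim hfu⟩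
  · have hf : f ∈ maximalIdeal S := (IsLocalRing.mem_maximalIdeal f).mpr (mem_nonunits_iff.mpr hfu)
    obtain ⟨P, hP, -, -, hE⟩ := topStratum_iotaOrdEpsTau_eq hdim hf0 hf
    exact ⟨P, hP, hE⟩

section Cylinder

variable (ι : (R : Type) → [CommRing R] → R → Ordinal.{0})

/-- **THE CYLINDER CLAUSE (c8-cyl)≤3 ALONG THE `ι₀`-STRATA, for every iso-invariant second letter `ι` and every `p`**:
`IotaUpperSemicontinuousOnLE 3 p iotaOrdEpsTau (iotaCylinder iotaOrdEpsTau ι)`.  See the module docstring for the proof (maximal points of the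
closed super-level sets of `ι₀`, `TieFinite.finite_setOf_isMaximalIn`; the generic point of the top `ι₀`-stratum through `y` is the unique such
point above `y` in the stratum). [OURS · (c8-cyl)≤3] -/
theorem iotaCylinder_upperSemicontinuousOnLE_three (hiso : IotaIsoInvariant ι) (p : ℕ) :
    IotaUpperSemicontinuousOnLE 3 p iotaOrdEpsTau (iotaCylinder iotaOrdEpsTau ι) := by
  intro k₀ _ _ _ Y hY _ _ hdim f α β
  classical
  haveI : NoetherianSpace Y := Theorems.noetherianSpace_of_smooth_quasiCompact hY
  -- notation: the stratifier, the pointwise second key and the cylinder at the stalk germs of `f`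
  set ν₀ : Y → Ordinal.{0} := fun y => iotaOrdEpsTau (Y.presheaf.stalk y) ((Y.presheaf.germ ⊤ y trivial) f) with hν₀
  set ρ : Y → Ordinal.{0} := fun y => ι (Y.presheaf.stalk y) ((Y.presheaf.germ ⊤ y trivial) f) with hρ
  set cyl : Y → Ordinal.{0} := fun y =>
    iotaCylinder iotaOrdEpsTau ι (Y.presheaf.stalk y) ((Y.presheaf.germ ⊤ y trivial) f) with hcyl
  -- (c7) and (c8)≤3 for the stratifier
  have hmono : ∀ {x y : Y}, x ⤳ y → ν₀ x ≤ ν₀ y := fun hxy => iotaOrdEpsTau_le_of_specializes hY f hxy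
  have hF : IsClosed {y : Y | α ≤ ν₀ y} := iotaOrdEpsTau_upperSemicontinuousLE_three p k₀ Y hY hdim f α
  -- KEY: the generic point `η` of the top `ι₀`-stratum through a point `y` of the stratum `{ι₀ = α}`
  have key : ∀ y : Y, ν₀ y = α → ∃ η : Y, η ⤳ y ∧ ν₀ η = α ∧ (∀ θ : Y, θ ⤳ η → θ ≠ η → ν₀ θ ≠ α) ∧
      cyl y = ρ η ∧ (∀ x : Y, x ⤳ y → ν₀ x = α → η ⤳ x) := by
    intro y hνy
    -- an affine chart through `y`
    have hytop : y ∈ (⊤ : Y.Opens) := trivial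
    rw [← iSup_affineOpens_eq_top Y] at hytop
    obtain ⟨U, hy⟩ := Opens.mem_iSup.mp hytop
    letI algy := TopCat.Presheaf.algebra_section_stalk Y.presheaf (⟨y, hy⟩ : (U : Y.Opens))
    haveI hlocy : IsLocalization.AtPrime (Y.presheaf.stalk y) (U.2.primeIdealOf ⟨y, hy⟩).asIdeal :=
      U.2.isLocalization_stalk ⟨y, hy⟩
    haveI : IsRegularLocalRing (Y.presheaf.stalk y) := isRegularLocalRing_stalk_of_smooth_of_field hY y
    -- the top `ι₀`-stratum of `Spec 𝒪_{Y,y}` is `V(P)`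
    obtain ⟨P, hP, hE⟩ := exists_topStratum_iotaOrdEpsTau_eq (Y.presheaf.stalk y) (hdim y) ((Y.presheaf.germ ⊤ y trivial) f)
    have hcylP : cyl y = ι (Localization.AtPrime P) (algebraMap (Y.presheaf.stalk y) (Localization.AtPrime P)
        ((Y.presheaf.germ ⊤ y trivial) f)) := iotaCylinder_eq_of_topStratum_eq iotaOrdEpsTau ι _ _ hE
    have hmemE : ∀ Q : PrimeSpectrum (Y.presheaf.stalk y),
        iotaOrdEpsTau (Localization.AtPrime Q.asIdeal) (algebraMap (Y.presheaf.stalk y) (Localization.AtPrime Q.asIdeal)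
          ((Y.presheaf.germ ⊤ y trivial) f)) = α ↔ P ≤ Q.asIdeal := by
      intro Q
      have h := Set.ext_iff.mp hE Q
      rw [ContactCylinder.mem_topStratum_iff, Set.mem_setOf_eq] at h
      rw [← h]
      change _ = α ↔ _ = ν₀ y
      rw [hνy]
    -- the point `η` of `P`
    set q : PrimeSpectrum Γ(Y, U) := ⟨P.comap (algebraMap Γ(Y, U) (Y.presheaf.stalk y)), inferInstance⟩ with hq
    have hqle : q.asIdeal ≤ (U.2.primeIdealOf ⟨y, hy⟩).asIdeal :=
      comap_le_of_isLocalization_atPrime (U.2.primeIdealOf ⟨y, hy⟩).asIdeal (Y.presheaf.stalk y) P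
    have hηU : U.2.fromSpec q ∈ (U : Y.Opens) := fromSpec_mem U q
    have hpη : U.2.primeIdealOf ⟨U.2.fromSpec q, hηU⟩ = q := primeIdealOf_fromSpec U q hηU
    have hηy : U.2.fromSpec q ⤳ y := (GenerizationClosed.le_primeIdealOf_iff_specializes U hy q).mp hqle
    have htransη : ∀ (P' : (R : Type) → [CommRing R] → R → Prop),
        (∀ (R T : Type) [CommRing R] [CommRing T] (e : R ≃+* T) (g : R), P' R g ↔ P' T (e g)) →
        (P' (Localization.AtPrime P) (algebraMap (Y.presheaf.stalk y) (Localization.AtPrime P)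
            ((Y.presheaf.germ ⊤ y trivial) f)) ↔
          P' (Y.presheaf.stalk (U.2.fromSpec q)) ((Y.presheaf.germ ⊤ (U.2.fromSpec q) trivial) f)) := fun P' hP' =>
      GenerizationClosed.localization_stalk_iff P' U hP' f hy ⟨P, hP⟩ hηU (U.2.isLocalization_stalk' q hηU)
    refine ⟨U.2.fromSpec q, hηy, ?_, ?_, ?_, ?_⟩
    · -- `ν₀ η = α`: `P` lies in the top stratum
      exact (htransη (fun R _ g => iotaOrdEpsTau R g = α)
        (fun R T _ _ e g => by rw [iotaOrdEpsTau_isoInvariant R T e g])).mp ((hmemE ⟨P, hP⟩).mpr le_rfl)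
    · -- generizations `θ ≠ η` of `η` are primes `Q < P`, off the top stratum
      intro θ hθη hne
      have hθU : θ ∈ (U : Y.Opens) := hθη.mem_open U.1.isOpen hηU
      obtain ⟨Q, hQcomap, htransθ⟩ := GenerizationClosed.exists_prime_of_specializes U f hy hθU (hθη.trans hηy)
      have hθq : (U.2.primeIdealOf ⟨θ, hθU⟩).asIdeal ≤ q.asIdeal := by
        have h := primeIdealOf_le_of_specializes U hηU hθU hθη
        rwa [hpη] at h
      have hQP : Q.asIdeal ≤ P := by
        have h1 := IsLocalization.map_under (M := (U.2.primeIdealOf ⟨y, hy⟩).asIdeal.primeCompl) (Y.presheaf.stalk y) Q.asIdeal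
        have h2 := IsLocalization.map_under (M := (U.2.primeIdealOf ⟨y, hy⟩).asIdeal.primeCompl) (Y.presheaf.stalk y) P
        rw [Ideal.under_def] at h1 h2
        rw [← h1, ← h2]
        exact Ideal.map_mono (hQcomap.symm ▸ hθq)
      have hQne : Q.asIdeal ≠ P := by
        intro heq
        apply hne
        have h1 : (U.2.primeIdealOf ⟨θ, hθU⟩).asIdeal = q.asIdeal := by rw [← hQcomap, heq]
        have h2 : U.2.primeIdealOf ⟨θ, hθU⟩ = U.2.primeIdealOf ⟨U.2.fromSpec q, hηU⟩ := by
          rw [hpη]; exact PrimeSpectrum.ext h1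
        have h3 := U.2.fromSpec_primeIdealOf ⟨θ, hθU⟩
        rw [h2, U.2.fromSpec_primeIdealOf] at h3
        exact h3.symm
      have hnot : ¬ P ≤ Q.asIdeal := fun hle => hQne (le_antisymm hQP hle)
      intro hνθ
      apply hnot
      exact (hmemE Q).mp ((htransθ (fun R _ g => iotaOrdEpsTau R g = α)
        (fun R T _ _ e g => by rw [iotaOrdEpsTau_isoInvariant R T e g])).mpr hνθ)
    · -- the cylinder reads `ι` at `η`
      rw [hcylP]
      exact (htransη (fun R _ g => ι R g = ρ (U.2.fromSpec q)) (fun R T _ _ e g => by rw [hiso R T e g])).mpr rfl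
    · -- every point of the stratum above `y` lies below `η`
      intro x hxy hνx
      have hxU : x ∈ (U : Y.Opens) := hxy.mem_open U.1.isOpen hy
      obtain ⟨Q, hQcomap, htransx⟩ := GenerizationClosed.exists_prime_of_specializes U f hy hxU hxy
      have hPQ : P ≤ Q.asIdeal := (hmemE Q).mp ((htransx (fun R _ g => iotaOrdEpsTau R g = α)
        (fun R T _ _ e g => by rw [iotaOrdEpsTau_isoInvariant R T e g])).mpr hνx)
      have hqx : q.asIdeal ≤ (U.2.primeIdealOf ⟨x, hxU⟩).asIdeal := by
        rw [← hQcomap]; exact Ideal.comap_mono hPQ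
      exact (GenerizationClosed.le_primeIdealOf_iff_specializes U hxU q).mp hqx
  -- the finitely many maximal points of `{α ≤ ι₀}` in the stratum with `β ≤ ι` pointwise, and the closed set `C`
  set M : Set Y := {x : Y | x ∈ {y : Y | α ≤ ν₀ y} ∧ ∀ x' ∈ {y : Y | α ≤ ν₀ y}, x' ⤳ x → x' = x} with hM
  have hMfin : M.Finite := TieFinite.finite_setOf_isMaximalIn hF
  set Mβ : Set Y := {x : Y | x ∈ M ∧ ν₀ x = α ∧ β ≤ ρ x} with hMβ
  have hMβfin : Mβ.Finite := hMfin.subset fun x hx => hx.1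
  refine ⟨⋃ x ∈ Mβ, closure {x}, hMβfin.isClosed_biUnion fun _ _ => isClosed_closure, ?_⟩
  ext y
  simp only [Set.mem_inter_iff, Set.mem_setOf_eq, Set.mem_iUnion, exists_prop]
  constructor
  · rintro ⟨⟨x, hxMβ, hyx⟩, hνy⟩
    refine ⟨hνy, ?_⟩
    have hxy : x ⤳ y := specializes_iff_mem_closure.mpr hyx
    obtain ⟨η, -, hνη, -, hcylη, hbelow⟩ := key y hνy
    have hηx : η ⤳ x := hbelow x hxy hxMβ.2.1
    have hηeq : η = x := hxMβ.1.2 η (show α ≤ ν₀ η from le_of_eq hνη.symm) hηx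
    show β ≤ cyl y
    rw [hcylη, hηeq]
    exact hxMβ.2.2
  · rintro ⟨hνy, hβ⟩
    obtain ⟨η, hηy, hνη, hmaxη, hcylη, -⟩ := key y hνy
    refine ⟨⟨η, ⟨⟨show α ≤ ν₀ η from le_of_eq hνη.symm, fun x' hx' hx'η => ?_⟩, hνη, ?_⟩,
      specializes_iff_mem_closure.mp hηy⟩, hνy⟩
    · by_contra hne
      have hle : ν₀ x' ≤ α := hνη ▸ hmono hx'η
      exact hmaxη x' hx'η hne (le_antisymm hle hx')
    · show β ≤ ρ η
      rw [← hcylη]; exact hβ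

/-- The same for the letter of record `σ`. [OURS · (c8-cyl)≤3] -/
theorem iotaCylinder_iotaSigma_upperSemicontinuousOnLE_three (p : ℕ) :
    IotaUpperSemicontinuousOnLE 3 p iotaOrdEpsTau (iotaCylinder iotaOrdEpsTau iotaSigma) :=
  iotaCylinder_upperSemicontinuousOnLE_three iotaSigma iotaSigma_isoInvariant p

end Cylinder

/-- **THE GAP hc8 OF THE P3 RUNG, UNCONDITIONAL**: (c8)≤3,p for the invariant of record `ι₃ᵗ = iotaFlatT`, every `p`. [OURS · hc8 CLOSED] -/
theorem iotaFlatT_upperSemicontinuousLE_three (p : ℕ) : IotaUpperSemicontinuousLE 3 p iotaFlatT :=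
  iotaFlatT_upperSemicontinuousLE_three_of_cylinder p (iotaCylinder_iotaSigma_upperSemicontinuousOnLE_three p)

end Iota3

/-! ## §4 The P3 rung for the named pair modulo the remaining gap list -/

/-- **P3 RUNG FOR THE NAMED PAIR MODULO THE REMAINING GAP LIST** (`keyRungGrHomLE_three_of_residue_at_powers` with hc8 DISCHARGED by
`Iota3.iotaFlatT_upperSemicontinuousLE_three`): `KeyRungGrHomLE 3 p` from (c10)≤3, (c11)≤3, (c9′-hom)≤3, the residue of the dominance word at the
power positions, and (c8-gr)≤3.  The hypothesis list is the gap list of the registered stub `stub_keyRungGrHomLE_three` after this file.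
[OURS · audit glue] -/
theorem keyRungGrHomLE_three_of_residue_at_powers' (p : ℕ)
    (hc10 : IotaTorusFactorMonotoneLE 3 p Iota3.iotaFlatT)
    (hc11 : IotaJEssSmoothCompatibleLE 3 Iota3.iotaFlatT Iota3.jFlatT)
    (hgame : CanonicalGameClauseHomLE 3 p Iota3.iotaFlatT Iota3.jFlatT)
    (hres : ∀ (k₀ : Type) [Field k₀] [CharP k₀ p] [PerfectField k₀]
      (S : Type) [CommRing S] [Algebra k₀ S] [Algebra.EssFiniteType k₀ S] [IsRegularLocalRing S] (f : S),
      ringKrullDim S = (3 : ℕ) → f ≠ 0 → f ∈ (maximalIdeal S) ^ 2 →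
      ContactCylinder.topStratumPrime Iota3.iotaOrdEpsTau S f = maximalIdeal S → Iota3.iotaEps S f ≠ 1 →
      (∃ ℓ ∈ maximalIdeal S, f ∈ Ideal.span {ℓ ^ (adicOrder f).toNat} ⊔ maximalIdeal S ^ ((adicOrder f).toNat + 1)) →
      ∀ (a b : ℕ), 0 < b →
      (∀ q' r₁' r₂' : ℕ, Iota3.AdmissibleTriple q' r₁' r₂' → Iota3.FlagReaches f (adicOrder f).toNat q' r₁' r₂' →
        r₁' * b ≤ a * r₂') →
      ∀ (g₁ g₂ g₁' g₂' : S) (q r₁ r₂ : ℕ), Iota3.AdmissibleTriple q r₁ r₂ → r₁ * b = a * r₂ → q < r₂ → r₂ < r₁ →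
        Iota3.IsTwoFlag g₁ g₂ → Iota3.IsTwoFlag g₁' g₂' →
        f ∈ Iota3.flagContactFiltration g₁ g₂ q r₁ r₂ (r₁ * (adicOrder f).toNat) →
        f ∈ Iota3.flagContactFiltration g₁' g₂' q r₁ r₂ (r₁ * (adicOrder f).toNat) →
        g₂' ∈ Iota3.flagContactFiltration g₁ g₂ q r₁ r₂ r₂)
    (hgr : IotaUpperSemicontinuousGradedLE 3 p Iota3.iotaFlatT) :
    KeyRungGrHomLE 3 p :=
  keyRungGrHomLE_three_of_residue_at_powers p (Iota3.iotaFlatT_upperSemicontinuousLE_three p) hc10 hc11 hgame hres hgr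

/-- The same in the registrar's `∀ p` shape of `stub_keyRungGrHomLE_three`. [OURS · audit glue] -/
theorem keyRungGrHomLE_three_forall_of_residue_at_powers'
    (hc10 : ∀ p : ℕ, p.Prime → IotaTorusFactorMonotoneLE 3 p Iota3.iotaFlatT)
    (hc11 : IotaJEssSmoothCompatibleLE 3 Iota3.iotaFlatT Iota3.jFlatT)
    (hgame : ∀ p : ℕ, p.Prime → CanonicalGameClauseHomLE 3 p Iota3.iotaFlatT Iota3.jFlatT)
    (hres : ∀ p : ℕ, p.Prime → ∀ (k₀ : Type) [Field k₀] [CharP k₀ p] [PerfectField k₀]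
      (S : Type) [CommRing S] [Algebra k₀ S] [Algebra.EssFiniteType k₀ S] [IsRegularLocalRing S] (f : S),
      ringKrullDim S = (3 : ℕ) → f ≠ 0 → f ∈ (maximalIdeal S) ^ 2 →
      ContactCylinder.topStratumPrime Iota3.iotaOrdEpsTau S f = maximalIdeal S → Iota3.iotaEps S f ≠ 1 →
      (∃ ℓ ∈ maximalIdeal S, f ∈ Ideal.span {ℓ ^ (adicOrder f).toNat} ⊔ maximalIdeal S ^ ((adicOrder f).toNat + 1)) →
      ∀ (a b : ℕ), 0 < b →
      (∀ q' r₁' r₂' : ℕ, Iota3.AdmissibleTriple q' r₁' r₂' → Iota3.FlagReaches f (adicOrder f).toNat q' r₁' r₂' →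
        r₁' * b ≤ a * r₂') →
      ∀ (g₁ g₂ g₁' g₂' : S) (q r₁ r₂ : ℕ), Iota3.AdmissibleTriple q r₁ r₂ → r₁ * b = a * r₂ → q < r₂ → r₂ < r₁ →
        Iota3.IsTwoFlag g₁ g₂ → Iota3.IsTwoFlag g₁' g₂' →
        f ∈ Iota3.flagContactFiltration g₁ g₂ q r₁ r₂ (r₁ * (adicOrder f).toNat) →
        f ∈ Iota3.flagContactFiltration g₁' g₂' q r₁ r₂ (r₁ * (adicOrder f).toNat) →
        g₂' ∈ Iota3.flagContactFiltration g₁ g₂ q r₁ r₂ r₂)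
    (hgr : ∀ p : ℕ, p.Prime → IotaUpperSemicontinuousGradedLE 3 p Iota3.iotaFlatT) :
    ∀ p : ℕ, p.Prime → KeyRungGrHomLE 3 p :=
  fun p hp => keyRungGrHomLE_three_of_residue_at_powers' p (hc10 p hp) hc11 (hgame p hp) (hres p hp) (hgr p hp)

end Summit.ResolutionOfSingularities.ResolutionOfSingularities.Cruxes.HypersurfaceCentreConstruction.LocalEngine

end
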